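import Mathlib

/-!
# Comparison principle for Metzler coupling matrices (solo-blind s81, §24.92 (T-b))

The within-step closure of the J-tail certificate bounds the block amplitudes `g_m(t) = ‖π_m u(t)‖`
of the tail of the chain by the solution of the linear comparison system `w' = N w (+ forcing)`,
`N = diag(s⁺) + C` with `C ≥ 0`: a METZLER matrix (off-diagonal entries `≥ 0`, diagonal of any sign).

* `metzler_comparison` — if every component `g_i` is continuous on `[a,b]`, has upper-right
  Dini slopes bounded by `(N g(t))_i` (in the `∀ᶠ` form that norms of differentiable curves satisfy),
  `w` is differentiable with the STRICT supersolution property `(N w(t))_i < w_i'(t)`, and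
  `g(a) ≤ w(a)`, then `g ≤ w` componentwise on `[a,b]`.

The proof runs Mathlib's boundary-comparison lemma
(`image_le_of_liminf_slope_right_lt_deriv_boundary`) on `φ(t) = max_i (g_i − w_i)(t)` with the Dini
bound taken over the indices attaining the maximum; the Metzler sign condition is exactly what makes
`(N g)_i ≤ (N w)_i` at an index where `g_i = w_i` and `g ≤ w`.
-/

namespace Summit.AnomalousDissipation.AnomalousDissipation.Theorems

open Finset Set Filter Topology

/-- **Comparison principle for a Metzler coupling matrix** (strict supersolutions dominate). -/
theorem metzler_comparison {K : ℕ} (N : Fin K → Fin K → ℝ) (hN : ∀ i j, i ≠ j → 0 ≤ N i j)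
    (g w w' : ℝ → Fin K → ℝ) (a b : ℝ)
    (hg : ∀ i, ContinuousOn (fun t => g t i) (Icc a b))
    (hDini : ∀ x ∈ Ico a b, ∀ i, ∀ r : ℝ, (∑ j, N i j * g x j) < r →
      ∀ᶠ s in 𝓝[>] x, slope (fun t => g t i) x s < r)
    (hw : ∀ x i, HasDerivAt (fun t => w t i) (w' x i) x)
    (hsuper : ∀ x ∈ Ico a b, ∀ i, (∑ j, N i j * w x j) < w' x i)
    (ha : ∀ i, g a i ≤ w a i) :
    ∀ x ∈ Icc a b, ∀ i, g x i ≤ w x i := by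
  rcases isEmpty_or_nonempty (Fin K) with hK | hK
  · exact fun x _ i => (IsEmpty.false i).elim
  have hne : (univ : Finset (Fin K)).Nonempty := univ_nonempty
  -- the barrier function φ = max_i (g_i - w_i)
  set h : ℝ → Fin K → ℝ := fun t i => g t i - w t i with hh
  set φ : ℝ → ℝ := fun t => univ.sup' hne (fun i => h t i) with hφ
  have hwc : ∀ i, ContinuousOn (fun t => w t i) (Icc a b) :=
    fun i x _ => (hw x i).continuousAt.continuousWithinAt
  have hhc : ∀ i, ContinuousOn (fun t => h t i) (Icc a b) := fun i => (hg i).sub (hwc i)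
  have hφc : ContinuousOn φ (Icc a b) := ContinuousOn.finset_sup'_apply hne fun i _ => hhc i
  have hle_φ : ∀ t i, h t i ≤ φ t := fun t i => le_sup' (fun i => h t i) (mem_univ i)
  -- indices attaining the maximum at x, and the Dini bound f' taken over them
  set I : ℝ → Finset (Fin K) := fun x => univ.filter (fun i => h x i = φ x) with hI
  have hIne : ∀ x, (I x).Nonempty := by
    intro x
    obtain ⟨i, _, hi⟩ := exists_mem_eq_sup' hne (fun i => h x i)
    exact ⟨i, by simp only [hI, Finset.mem_filter, Finset.mem_univ, true_and]; exact hi.symm⟩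
  set f' : ℝ → ℝ := fun x => (I x).sup' (hIne x) (fun i => (∑ j, N i j * g x j) - w' x i) with hf'
  -- slopes
  have hwslope : ∀ x i, Tendsto (slope (fun t => w t i) x) (𝓝[>] x) (𝓝 (w' x i)) := by
    intro x i
    have h1 := (hasDerivAt_iff_tendsto_slope.mp (hw x i))
    exact h1.mono_left (nhdsWithin_mono _ fun y (hy : x < y) => ne_of_gt hy)
  have hslope_sub : ∀ x s i, slope (fun t => h t i) x s =
      slope (fun t => g t i) x s - slope (fun t => w t i) x s := by
    intro x s i
    simp only [hh, slope, vsub_eq_sub, smul_eq_mul]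
    ring
  -- right-neighbourhoods of x ∈ [a,b) stay inside [a,b]
  have hnhds : ∀ x ∈ Ico a b, 𝓝[>] x ≤ 𝓝[Icc a b] x := by
    intro x hx
    refine nhdsWithin_le_iff.mpr (mem_of_superset (Icc_mem_nhdsGT hx.2) ?_)
    exact Icc_subset_Icc hx.1 le_rfl
  -- Dini bound for φ
  have hφ' : ∀ x ∈ Ico a b, ∀ r, f' x < r → ∃ᶠ s in 𝓝[>] x, slope φ x s < r := by
    intro x hx r hr
    set ε := r - f' x with hε
    have hεpos : 0 < ε := by simp only [hε]; linarith
    -- attaining indices: slope bound; non-attaining indices: stay strictly below φ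
    have hev : ∀ i, ∀ᶠ s in 𝓝[>] x,
        (slope (fun t => h t i) x s < (∑ j, N i j * g x j) - w' x i + ε) ∧
        (h x i < φ x → h s i < φ s) := by
      intro i
      have e1 : ∀ᶠ s in 𝓝[>] x, slope (fun t => g t i) x s < (∑ j, N i j * g x j) + ε / 2 :=
        hDini x hx i _ (by linarith)
      have e2 : ∀ᶠ s in 𝓝[>] x, w' x i - ε / 2 < slope (fun t => w t i) x s :=
        (hwslope x i).eventually (Ioi_mem_nhds (by linarith))
      have e3 : ∀ᶠ s in 𝓝[>] x, h x i < φ x → h s i < φ s := by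
        by_cases hlt : h x i < φ x
        · have hct : ContinuousWithinAt (fun t => h t i - φ t) (Icc a b) x :=
            ((hhc i).sub hφc) x ⟨hx.1, hx.2.le⟩
          have ht : Tendsto (fun t => h t i - φ t) (𝓝[>] x) (𝓝 (h x i - φ x)) :=
            hct.tendsto.mono_left (hnhds x hx)
          have hneg : h x i - φ x < 0 := by linarith
          filter_upwards [ht.eventually (Iio_mem_nhds hneg)] with s hs _
          have : h s i - φ s < 0 := hs
          linarith
        · exact Eventually.of_forall fun s hcon => absurd hcon hlt
      filter_upwards [e1, e2, e3] with s hs1 hs2 hs3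
      refine ⟨?_, hs3⟩
      rw [hslope_sub]
      linarith
    have hall := eventually_all.mpr hev
    have hpos : ∀ᶠ s in 𝓝[>] x, x < s := eventually_nhdsWithin_of_forall fun s hs => hs
    refine ((hall.and hpos).mono fun s hs => ?_).frequently
    obtain ⟨hs, hxs⟩ := hs
    obtain ⟨i, _, hi⟩ := exists_mem_eq_sup' hne (fun i => h s i)
    have hφs : φ s = h s i := hi
    -- the attaining index at s attains at x as well
    have hiI : i ∈ I x := by
      simp only [hI, Finset.mem_filter, Finset.mem_univ, true_and]
      by_contra hcon
      have hlt : h x i < φ x := lt_of_le_of_ne (hle_φ x i) hcon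
      have := (hs i).2 hlt
      linarith
    have hbound_i : (∑ j, N i j * g x j) - w' x i ≤ f' x :=
      le_sup' (fun i => (∑ j, N i j * g x j) - w' x i) hiI
    have hsl : slope (fun t => h t i) x s < r := by
      have := (hs i).1; simp only [hε] at this; linarith
    have hsx : 0 < s - x := by linarith
    have hq : slope φ x s ≤ slope (fun t => h t i) x s := by
      simp only [slope, vsub_eq_sub, smul_eq_mul]
      rw [hφs]
      exact mul_le_mul_of_nonneg_left (by linarith [hle_φ x i]) (inv_nonneg.mpr hsx.le)
    exact lt_of_le_of_lt hq hsl
  -- barrier: φ x = 0 ⇒ f' x < 0  (Metzler monotonicity at an attaining index)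
  have hbar : ∀ x ∈ Ico a b, φ x = (fun _ => (0:ℝ)) x → f' x < (fun _ => (0:ℝ)) x := by
    intro x hx hφ0
    have hle : ∀ j, g x j ≤ w x j := by
      intro j
      have := hle_φ x j
      rw [hφ0] at this
      simp only [hh] at this
      linarith
    simp only [hf']
    rw [sup'_lt_iff]
    intro i hi
    simp only [hI, Finset.mem_filter, Finset.mem_univ, true_and] at hi
    have heq : g x i = w x i := by
      have : h x i = 0 := by rw [hi]; exact hφ0
      simp only [hh] at this
      linarith
    have hmono : (∑ j, N i j * g x j) ≤ ∑ j, N i j * w x j := by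
      apply sum_le_sum
      intro j _
      by_cases hij : i = j
      · subst hij; rw [heq]
      · exact mul_le_mul_of_nonneg_left (hle j) (hN i j hij)
    have := hsuper x hx i
    linarith
  have hφa : φ a ≤ (fun _ => (0:ℝ)) a := by
    simp only [hφ]
    rw [sup'_le_iff]
    intro i _
    simp only [hh]
    linarith [ha i]
  have hB : ∀ x, HasDerivAt (fun _ : ℝ => (0:ℝ)) ((fun _ => (0:ℝ)) x) x :=
    fun x => hasDerivAt_const x 0
  have hres := image_le_of_liminf_slope_right_lt_deriv_boundary hφc hφ' hφa hB hbar
  intro x hx i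
  have h1 := hle_φ x i
  have h2 : φ x ≤ 0 := hres hx
  simp only [hh] at h1
  linarith

end Summit.AnomalousDissipation.AnomalousDissipation.Theorems
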